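import Mathlib
import HarnessLib
import Summits.KontsevichZagierPeriods.KontsevichZagierPeriods.Theorems.SoloInformedSawtoothFunctional

/-!
# SoloInformed — the degenerate triplication move is factorwise at EVERY level
(level-free class certificate; paper/main.md §7 (c6)(xi)(A), solo-informed, s74)

Context. In the Beta calculus `𝒞_GM` of the paper (states = multisets of Beta symbols `B(a/N,b/N)`;
moves E1 = two-term `ℚ̄`-relations granted Huber–Wüstholz, D, T, Ev, and Gauss multiplication `GM_n`),
the only multiplication moves that can act on a two-symbol state (`φ = 2`) are `GM₂` and the DEGENERATE
triplication `GM₃(1/3, s)`:  `B(1/3,s)·B(2/3,s) = (rational)·3^{…}·B(s,s)·B(2s,s)` (the symbols `B(1,s)`,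
`B(1,3s)` evaluated). Section (xi)(A) proved that `GM₂` is class-neutral modulo the two-term lattice
`V_lin(N)` structurally, but for `GM₃(1/3,·)` only BY CHECK at eleven levels, so the statement
"Gauss-1812-at-25 is not derivable without a catalyst" was unconditional only at levels prime to `3`.

This file removes the check: for EVERY level `N`, every `t` with `3t = 0`, `t ≠ 0` (so `t = N/3` or
`2N/3`) and every admissible `s` (`2s, 3s ≠ 0`), the class vector of the evaluated degenerate
triplication move,
  `gm₃(t,s) := vec B(t,s) + vec B(2t,s) - vec B(s,s) - vec B(2s,s)`,
lies in the level-free two-term lattice `soloInformedTwoTermLattice N` (= `V_lin(N)` of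
`SoloInformedSawtoothFunctional`). MECHANISM (Aoki's family III, i.e. triplication in two-term form):
  `gm₃(t,s) = -(vec B(2s,s) - vec B(t-s,2t-s)) - (r(s+t) + r(s+2t) - r(t) - r(2s))`,
`r(x) = e_x + e_{-x}`, where `B(2s,s)` and `B(t-s,2t-s)` HAVE THE SAME CM TYPE at every unit
(`soloInformed_familyIII_tauAt`; analytically `B(2s,s)/B(1/3-s,2/3-s) = sin 3πs/(2·3^{3s-1/2} sin πs sin 2πs)`)
and every difference of reflection vectors is a same-triple two-term generator
(`soloInformed_reflVec_sub_mem_twoTermLattice`). Consequently (xi)(A) holds verbatim at every level: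
the `φ = 2` instances of Conjecture 1 with class outside `V_lin` (Gauss 1812 at 25, the two-term
`σ_{p,x}` forms) admit no catalyst-free derivation in `𝒞_GM` at ANY level (paper, (c6)(xii) addendum s74).
All statements are for every `N`; there is no `decide`.
-/

namespace Summit.KontsevichZagierPeriods.KontsevichZagierPeriods.Theorems

/-! ## Carry arithmetic in `ℤ/N` -/

/-- `(a+b).val` is `a.val + b.val` or `a.val + b.val - N`. -/
theorem soloInformed_val_add_cases (N : ℕ) [NeZero N] (a b : ZMod N) :
    (a + b).val = a.val + b.val ∨ (a + b).val + N = a.val + b.val := by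
  rw [ZMod.val_add]
  have ha := ZMod.val_lt a
  have hb := ZMod.val_lt b
  have h := Nat.mod_add_div (a.val + b.val) N
  have hq : (a.val + b.val) / N < 2 := by
    apply Nat.div_lt_of_lt_mul; omega
  interval_cases hd : (a.val + b.val) / N <;> omega

/-- `(-a).val = N - a.val` for `a ≠ 0`. -/
theorem soloInformed_val_neg_of_ne (N : ℕ) [NeZero N] {a : ZMod N} (ha : a ≠ 0) :
    (-a).val = N - a.val := by
  rw [ZMod.neg_val, if_neg ha]

/-- The CM-type bit at a multiplier `m` is the bit at `1` of the multiplied symbol. -/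
theorem soloInformed_tauAt_eq_tauAt_one (N : ℕ) (a b m : ZMod N) :
    soloInformedTauAt N a b m = soloInformedTauAt N (m * a) (m * b) 1 := by
  simp only [soloInformedTauAt, one_mul, mul_add]

/-! ## Aoki's family III: `B(2s,s)` and `B(t-s,2t-s)` (`3t = 0`) have the same CM type -/

/-- The carry identity behind family III (numerators of the CM bits at the multiplier `1`). -/
theorem soloInformed_familyIII_carry (N : ℕ) [NeZero N] {s t : ZMod N} (ht : 3 * t = 0) (ht0 : t ≠ 0)
    (hs2 : 2 * s ≠ 0) (hs3 : 3 * s ≠ 0) :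
    (2 * s).val + s.val - (2 * s + s).val =
      (t - s).val + (2 * t - s).val - ((t - s) + (2 * t - s)).val := by
  have hs0 : s ≠ 0 := by rintro rfl; simp at hs2
  have hN : 0 < N := Nat.pos_of_ne_zero (NeZero.ne N)
  have hy := ZMod.val_lt s
  have hy0 : s.val ≠ 0 := fun h => hs0 ((ZMod.val_eq_zero s).mp h)
  have hu := ZMod.val_lt t
  have hu0 : t.val ≠ 0 := fun h => ht0 ((ZMod.val_eq_zero t).mp h)
  -- 2s, 3s, 2t, 3t through `val_add_cases`
  have e2s : (2 : ZMod N) * s = s + s := two_mul s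
  have e3s : (2 : ZMod N) * s + s = s + s + s := by rw [e2s]
  have e2t : (2 : ZMod N) * t = t + t := two_mul t
  have e3t : t + t + t = 0 := by rw [← ht]; ring
  have h2s := soloInformed_val_add_cases N s s
  have h3s := soloInformed_val_add_cases N (s + s) s
  have h2t := soloInformed_val_add_cases N t t
  have h3t := soloInformed_val_add_cases N (t + t) t
  rw [e3t, ZMod.val_zero] at h3t
  have hv2 : (s + s).val ≠ 0 := fun h => hs2 (by rw [e2s]; exact (ZMod.val_eq_zero _).mp h)
  have hv3 : (s + s + s).val ≠ 0 := fun h => hs3 (by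
    rw [show (3 : ZMod N) * s = s + s + s by ring]; exact (ZMod.val_eq_zero _).mp h)
  have hv2lt := ZMod.val_lt (s + s)
  have hv3lt := ZMod.val_lt (s + s + s)
  have hu2lt := ZMod.val_lt (t + t)
  -- negatives
  have hns : (-s).val = N - s.val := soloInformed_val_neg_of_ne N hs0
  have hn2s : (-(s + s)).val = N - (s + s).val :=
    soloInformed_val_neg_of_ne N (by rw [← e2s]; exact hs2)
  -- t - s, 2t - s, and the sum
  have ets : t - s = t + -s := sub_eq_add_neg t s
  have e2ts : (2 : ZMod N) * t - s = (t + t) + -s := by rw [e2t, sub_eq_add_neg]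
  have esum : (t - s) + (2 * t - s) = -(s + s) := by linear_combination ht
  have hw1 := soloInformed_val_add_cases N t (-s)
  have hw2 := soloInformed_val_add_cases N (t + t) (-s)
  have hw1lt := ZMod.val_lt (t + -s)
  have hw2lt := ZMod.val_lt (t + t + -s)
  rw [e3s, e2s, esum, hn2s, ets, e2ts]
  rw [hns] at hw1 hw2
  omega

/-- FAMILY III (level-free). For `3t = 0`, `t ≠ 0`, `2s ≠ 0`, `3s ≠ 0`, the Beta symbols `B(2s,s)` and
`B(t-s, 2t-s)` have the same CM-type bit at every unit `m`. -/
theorem soloInformed_familyIII_tauAt (N : ℕ) [NeZero N] {s t : ZMod N} (ht : 3 * t = 0) (ht0 : t ≠ 0)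
    (hs2 : 2 * s ≠ 0) (hs3 : 3 * s ≠ 0) {m : ZMod N} (hm : IsUnit m) :
    soloInformedTauAt N (2 * s) s m = soloInformedTauAt N (t - s) (2 * t - s) m := by
  rw [soloInformed_tauAt_eq_tauAt_one, soloInformed_tauAt_eq_tauAt_one N (t - s)]
  have e1 : m * (2 * s) = 2 * (m * s) := by ring
  have e2 : m * (t - s) = m * t - m * s := by ring
  have e3 : m * (2 * t - s) = 2 * (m * t) - m * s := by ring
  rw [e1, e2, e3]
  have ht' : 3 * (m * t) = 0 := by rw [mul_left_comm, ht, mul_zero]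
  have ht0' : m * t ≠ 0 := fun h => ht0 (hm.mul_right_eq_zero.mp h)
  have hs2' : 2 * (m * s) ≠ 0 := by
    rw [mul_left_comm]; exact fun h => hs2 (hm.mul_right_eq_zero.mp h)
  have hs3' : 3 * (m * s) ≠ 0 := by
    rw [mul_left_comm]; exact fun h => hs3 (hm.mul_right_eq_zero.mp h)
  unfold soloInformedTauAt
  simp only [one_mul]
  rw [soloInformed_familyIII_carry N ht' ht0' hs2' hs3']

/-- The family-III two-term generator: `vec B(2s,s) - vec B(t-s,2t-s) ∈ V_lin(N)` at every level. -/
theorem soloInformed_familyIII_mem_twoTermLattice (N : ℕ) [NeZero N] {s t : ZMod N} (ht : 3 * t = 0)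
    (ht0 : t ≠ 0) (hs2 : 2 * s ≠ 0) (hs3 : 3 * s ≠ 0) :
    soloInformedBetaVec N (2 * s) s - soloInformedBetaVec N (t - s) (2 * t - s) ∈
      soloInformedTwoTermLattice N := by
  have hs0 : s ≠ 0 := by rintro rfl; simp at hs2
  apply Submodule.subset_span
  refine ⟨2 * s, s, t - s, 2 * t - s, ⟨hs2, hs0, ?_⟩, ⟨?_, ?_, ?_⟩, ?_, rfl⟩
  · rw [show (2 : ZMod N) * s + s = 3 * s by ring]; exact hs3
  · intro h
    apply hs3
    linear_combination (-3 : ZMod N) * h + ht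
  · intro h
    apply hs3
    linear_combination (-3 : ZMod N) * h + 2 * ht
  · rw [show (t - s) + (2 * t - s) = -(2 * s) by linear_combination ht]
    exact neg_ne_zero.mpr hs2
  · intro m hm
    exact soloInformed_familyIII_tauAt N ht ht0 hs2 hs3 hm

/-! ## Reflection differences are same-triple two-term generators -/

/-- Stripping the `e₀`-convention when the sum is non-zero. -/
theorem soloInformed_ite_and_ne_zero {N : ℕ} {p : ZMod N} (hp : p ≠ 0) (x : ZMod N) :
    (if p = x ∧ x ≠ 0 then (1 : ℤ) else 0) = if p = x then 1 else 0 := by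
  by_cases h : p = x
  · subst h; simp [hp]
  · simp [h]

/-- Same-triple carry identity: for `a = -x-y` the CM bits of `B(a,x)` and `B(a,y)` agree (numerators). -/
theorem soloInformed_sameTriple_carry (N : ℕ) [NeZero N] {x y : ZMod N} (hx : x ≠ 0) (hy : y ≠ 0)
    (hxy : x + y ≠ 0) (m : ZMod N) (hm : IsUnit m) :
    soloInformedTauAt N (-(x + y)) x m = soloInformedTauAt N (-(x + y)) y m := by
  rw [soloInformed_tauAt_eq_tauAt_one, soloInformed_tauAt_eq_tauAt_one N _ y]
  have hx' : m * x ≠ 0 := fun h => hx (hm.mul_right_eq_zero.mp h)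
  have hy' : m * y ≠ 0 := fun h => hy (hm.mul_right_eq_zero.mp h)
  have hxy' : m * x + m * y ≠ 0 := by
    rw [← mul_add]; exact fun h => hxy (hm.mul_right_eq_zero.mp h)
  have ea : m * (-(x + y)) = -(m * x + m * y) := by ring
  rw [ea]
  generalize m * x = X at hx' hxy' ⊢
  generalize m * y = Y at hy' hxy' ⊢
  unfold soloInformedTauAt
  simp only [one_mul]
  have e1 : -(X + Y) + X = -Y := by ring
  have e2 : -(X + Y) + Y = -X := by ring
  rw [e1, e2, soloInformed_val_neg_of_ne N hy', soloInformed_val_neg_of_ne N hx',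
    soloInformed_val_neg_of_ne N hxy']
  have hX := ZMod.val_lt X
  have hY := ZMod.val_lt Y
  have hX0 : X.val ≠ 0 := fun h => hx' ((ZMod.val_eq_zero X).mp h)
  have hY0 : Y.val ≠ 0 := fun h => hy' ((ZMod.val_eq_zero Y).mp h)
  have hS := soloInformed_val_add_cases N X Y
  have hSlt := ZMod.val_lt (X + Y)
  have hS0 : (X + Y).val ≠ 0 := fun h => hxy' ((ZMod.val_eq_zero _).mp h)
  congr 1
  omega

/-- The vector identity `vec B(a,x) - vec B(a,y) = r(x) - r(y)` for `a = -x-y`. -/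
theorem soloInformed_betaVec_sameTriple_sub (N : ℕ) {x y : ZMod N} (hx : x ≠ 0) (hy : y ≠ 0) :
    soloInformedBetaVec N (-(x + y)) x - soloInformedBetaVec N (-(x + y)) y =
      soloInformedReflVec N x - soloInformedReflVec N y := by
  have e1 : -(x + y) + x = -y := by ring
  have e2 : -(x + y) + y = -x := by ring
  funext z
  simp only [soloInformedBetaVec, soloInformedReflVec, Pi.sub_apply, e1, e2,
    soloInformed_ite_and_ne_zero (neg_ne_zero.mpr hy), soloInformed_ite_and_ne_zero (neg_ne_zero.mpr hx)]
  abel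

/-- Every difference of reflection vectors `r(x) - r(y)` (`x, y ≠ 0`) lies in the two-term lattice:
it is the same-triple generator `vec B(-x-y, x) - vec B(-x-y, y)` (or zero when `y = -x`). -/
theorem soloInformed_reflVec_sub_mem_twoTermLattice (N : ℕ) [NeZero N] {x y : ZMod N} (hx : x ≠ 0)
    (hy : y ≠ 0) :
    soloInformedReflVec N x - soloInformedReflVec N y ∈ soloInformedTwoTermLattice N := by
  by_cases hxy : x + y = 0
  · have hyx : y = -x := by linear_combination hxy
    have h0 : soloInformedReflVec N x - soloInformedReflVec N y = 0 := by
      funext z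
      simp only [soloInformedReflVec, Pi.sub_apply, Pi.zero_apply, hyx, neg_neg]
      abel
    rw [h0]
    exact Submodule.zero_mem _
  · rw [← soloInformed_betaVec_sameTriple_sub N hx hy]
    apply Submodule.subset_span
    refine ⟨-(x + y), x, -(x + y), y, ⟨neg_ne_zero.mpr hxy, hx, ?_⟩, ⟨neg_ne_zero.mpr hxy, hy, ?_⟩,
      fun m hm => soloInformed_sameTriple_carry N hx hy hxy m hm, rfl⟩
    · rw [show -(x + y) + x = -y by ring]; exact neg_ne_zero.mpr hy
    · rw [show -(x + y) + y = -x by ring]; exact neg_ne_zero.mpr hx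

/-! ## The degenerate triplication class and its membership in `V_lin(N)` -/

/-- Class vector of the evaluated degenerate triplication move `GM₃(t, s)`, `3t = 0`:
`{B(t,s), B(2t,s)} ↔ {B(s,s), B(2s,s)}` (the rational symbols `B(1,s)`, `B(1,3s)` evaluated). -/
def soloInformedGM3DegVec (N : ℕ) (t s : ZMod N) : ZMod N → ℤ :=
  soloInformedBetaVec N t s + soloInformedBetaVec N (2 * t) s -
    (soloInformedBetaVec N s s + soloInformedBetaVec N (2 * s) s)

/-- THE DECOMPOSITION: `gm₃(t,s) = -(vec B(2s,s) - vec B(t-s,2t-s)) - (r(s+t) + r(s+2t) - r(t) - r(2s))`. -/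
theorem soloInformed_gm3deg_decomp (N : ℕ) {s t : ZMod N} (ht : 3 * t = 0)
    (hs2 : 2 * s ≠ 0) (hs3 : 3 * s ≠ 0) :
    soloInformedGM3DegVec N t s =
      -(soloInformedBetaVec N (2 * s) s - soloInformedBetaVec N (t - s) (2 * t - s)) -
        (soloInformedReflVec N (t + s) + soloInformedReflVec N (2 * t + s) -
          soloInformedReflVec N t - soloInformedReflVec N (2 * s)) := by
  -- the five sums occurring under the `e₀`-convention are non-zero
  have hts : t + s ≠ 0 := fun h => hs3 (by linear_combination 3 * h - ht)
  have h2ts : 2 * t + s ≠ 0 := fun h => hs3 (by linear_combination 3 * h - 2 * ht)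
  have hss : s + s ≠ 0 := by rw [← two_mul]; exact hs2
  have h2ss : 2 * s + s ≠ 0 := by rw [show (2 : ZMod N) * s + s = 3 * s by ring]; exact hs3
  have hsum : (t - s) + (2 * t - s) ≠ 0 := by
    rw [show (t - s) + (2 * t - s) = -(2 * s) by linear_combination ht]; exact neg_ne_zero.mpr hs2
  -- point identifications forced by `3t = 0`
  have p1 : s + s = 2 * s := (two_mul s).symm
  have p2 : t - s = -(2 * t + s) := by linear_combination ht
  have p3 : 2 * t - s = -(t + s) := by linear_combination ht
  have p4 : (t - s) + (2 * t - s) = -(2 * s) := by linear_combination ht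
  have p5 : (2 : ZMod N) * t = -t := by linear_combination ht
  funext z
  simp only [soloInformedGM3DegVec, soloInformedBetaVec, soloInformedReflVec, Pi.add_apply,
    Pi.sub_apply, Pi.neg_apply, soloInformed_ite_and_ne_zero hts, soloInformed_ite_and_ne_zero h2ts,
    soloInformed_ite_and_ne_zero hss, soloInformed_ite_and_ne_zero h2ss,
    soloInformed_ite_and_ne_zero hsum]
  rw [p4, p2, p3, p1]
  simp only [p5, neg_add_rev, neg_neg]
  abel

/-- LEVEL-FREE FACTORWISE CERTIFICATE FOR THE DEGENERATE TRIPLICATION MOVE. For every level `N`, every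
`t` with `3t = 0`, `t ≠ 0` and every `s` with `2s ≠ 0`, `3s ≠ 0`, the class vector of `GM₃(t,s)` lies
in the two-term lattice `V_lin(N)`: the move is class-neutral modulo E1 at every level. -/
theorem soloInformed_gm3deg_mem_twoTermLattice (N : ℕ) [NeZero N] {s t : ZMod N} (ht : 3 * t = 0)
    (ht0 : t ≠ 0) (hs2 : 2 * s ≠ 0) (hs3 : 3 * s ≠ 0) :
    soloInformedGM3DegVec N t s ∈ soloInformedTwoTermLattice N := by
  have hs0 : s ≠ 0 := by rintro rfl; simp at hs2
  have hts : t + s ≠ 0 := fun h => hs3 (by linear_combination 3 * h - ht)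
  have h2ts : 2 * t + s ≠ 0 := fun h => hs3 (by linear_combination 3 * h - 2 * ht)
  rw [soloInformed_gm3deg_decomp N ht hs2 hs3]
  refine Submodule.sub_mem _ (Submodule.neg_mem _ ?_) ?_
  · exact soloInformed_familyIII_mem_twoTermLattice N ht ht0 hs2 hs3
  · have h1 := soloInformed_reflVec_sub_mem_twoTermLattice N hts ht0
    have h2 := soloInformed_reflVec_sub_mem_twoTermLattice N h2ts hs2
    have e : soloInformedReflVec N (t + s) + soloInformedReflVec N (2 * t + s) -
        soloInformedReflVec N t - soloInformedReflVec N (2 * s) =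
        (soloInformedReflVec N (t + s) - soloInformedReflVec N t) +
          (soloInformedReflVec N (2 * t + s) - soloInformedReflVec N (2 * s)) := by abel
    rw [e]
    exact Submodule.add_mem _ h1 h2

/-- Every unit sawtooth functional kills the degenerate triplication class (consistency with
`SoloInformedSawtoothFunctional`: `λ_m` annihilates `V_lin(N)`). -/
theorem soloInformed_sawFun_gm3deg (N : ℕ) [NeZero N] {s t : ZMod N} (ht : 3 * t = 0) (ht0 : t ≠ 0)
    (hs2 : 2 * s ≠ 0) (hs3 : 3 * s ≠ 0) {m : ZMod N} (hm : IsUnit m) :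
    soloInformedSawFun N m (soloInformedGM3DegVec N t s) = 0 :=
  soloInformed_sawFun_twoTermLattice N hm _ (soloInformed_gm3deg_mem_twoTermLattice N ht ht0 hs2 hs3)

/-- Instance check at level `25·3 = 75` (`t = 25`, `s = 12`, i.e. `GM₃(1/3, 4/25)`): the hypotheses hold. -/
example : (3 : ZMod 75) * 25 = 0 ∧ (25 : ZMod 75) ≠ 0 ∧ (2 : ZMod 75) * 12 ≠ 0 ∧ (3 : ZMod 75) * 12 ≠ 0 := by
  decide

end Summit.KontsevichZagierPeriods.KontsevichZagierPeriods.Theorems
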